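import Summits.Ventures.WeilGRH.TwistedTwoPrimeChainAbs
import Literature.NumberTheory.LFunctions.WeilFirstPrimeCertificateZ
import HarnessLib

/-!
# Moment-method certificates for TWISTED Weil weights, X: the TWO-PRIME certificate format `TwistCert23`

Cell `rh-explicit`, WEIL TRACK — GRH ARM (namespace `Summit.Ventures.WeilGRH`).  The two-prime analogue of `TwistCert` (`TwistedMomentCert.lean`; verbatim with `cells : List TPDCell`, `cellsMomentQ₂₃` / `cellsAbsMomentQ₂₃` / `cellsBndMaxQ₂₃`, chains `CellsOKW23`).  `TwistCert23` is the `ζ`-side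
Stage-C format `WeilCert3` (`Literature/NumberTheory/LFunctions/WeilFirstPrimeCertificateZ.lean`: parameters
`a₀, N, T`, level `wL`, dyadic cells, change of basis `C`, exact inverse `D`, PSD factors `U`, rounding
`pg`, claimed scaled moment table with tolerance `2^{-pnu}`) adapted to the TWISTED forms `Q_χ`, which have
NO polar term and a conductor-dependent constant level `ℓ = log q − log π`:

* the certified form is `E(g) = ℓ‖g‖₂² + (1/2π)∫|ĝ(1/2+iτ)|² W(τ) dτ` for ANY weight `W` minorised by the
  cell chain (`∀ τ, wL − γ(τ) ≤ W(τ)`, `γ = cellsGamma₂₃ wL cells` with the structural facts of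
  `CellsOKW23`, files I–II) and any real `ℓ ≥ ellLo` (`ellLo` a rational field of the certificate);
* the block machinery of `WeilCert` (which hard-wires the `ζ` polar Taylor matrix `Sym` in `WeilCert.pmQ`) is
  reused VERBATIM by shifting the claimed moment table: the table stores
  `nuScale·ν_q + (−1)^{q/2}·2(a₀/2)^q/invTwoPiHi`, so that `pmQ(table) = −invTwoPiHi20·Ĝ(ν)` up to the
  table tolerance (`TwistCert23.abs_pmQ_sub_pmQexact_le`, `TwistCert23.pmQexact_cast`) — the polar part cancels
  exactly, no new block code, no new kernel evaluator;
* `TwistCert23.kappaExact` — the coefficient of `‖g‖₂²` after all reductions: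
  `wL + ellLo − 7(q₂₀⁺ − q₂₀⁻)·max_j bnd_j − 2a₀(5 q₂₀⁺ ν'_abs + (N+1)²(2^{-pg} + invTwoPiHi·2^{-pnu}))`
  (the `ζ` polar price `η_P` is absent); `checkScalars`, `checkNu`, **`checkAlg`** (scalars, table, the two
  parity blocks; the CELLS are checked separately by the weight-specific Boolean checker of file II, or any
  future one, producing `CellsOKW23`);
* this file: the table lemmas and **Step C** (`TwistCert23.freq_integral_bound`: the frequency side in the
  moments, proof verbatim from `WeilCert3.freq_integral_bound` over `CellsOKW23`).  Step B and the soundness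
  theorem are in `TwistedMomentCertSound.lean`.

Everything here is PROVED; no named facts; nothing about zeros of any `L`-function.

## References

* H. Yoshida, *On Hermitian forms attached to zeta functions*, Adv. Stud. Pure Math. 21 (1992), §2 (2.1), §6,
  Theorem 1 (p. 310) — the moment method.
* A. Weil, *Sur les "formules explicites" de la théorie des nombres premiers* (1952), (11) pp. 261–262 (the
  twisted explicit formula; no polar term for `χ ≠ χ₀`).
-/

noncomputable section

open Complex Finset MeasureTheory Set Filter
open scoped Real Topology ComplexConjugate BigOperators

namespace Summit.Ventures.WeilGRH

open Literature.NumberTheory.LFunctions Literature.Analysis.ValidatedNumerics.Numerics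
open Literature.Analysis.SpecialFunctions

/-- A moment-method certificate for a POLAR-FREE form `ℓ‖g‖₂² + (1/2π)∫|ĝ|² W` on `C(b)`, `b ≤ a₀`: the
archimedean certificate format `WeilCert` (parameters, level `wL`, cut-off `T`, blocks; its own `cells` field
unused) + tolerance bits of the claimed table + the minorant cells on `[0, T]` + the support `b` + the claimed
SHIFTED scaled moment table + a rational lower bound `ellLo` of the constant level `ℓ`. [folklore] -/
structure TwistCert23 where
  /-- parameters, rounding, change of basis and PSD factors (format of `WeilCert`) -/
  frame : WeilCert
  /-- tolerance bits of the claimed moment table -/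
  pnu : ℕ
  /-- the cells of the minorant on `[0, T]` (checked by a weight-specific Boolean checker, not by `checkAlg`) -/
  cells : List TPDCell
  /-- the support half-length of the target cone (`tsupport g ⊆ [-b, b]`, `b ≤ a₀`) -/
  b : ℚ
  /-- the claimed table `nuScale·ν_q + (−1)^{q/2}·2(a₀/2)^q/invTwoPiHi`, `q ≤ 2N` even (see `checkNu`) -/
  nuData : List ℚ
  /-- a rational lower bound of the constant level `ℓ` of the form (e.g. `≤ log q − log π`) -/
  ellLo : ℚ

namespace TwistCert23

variable (c : TwistCert23)

/-- The scaled moments `ν_q = a₀^q ∫ γ(t) t^q dt` of the minorant defect. [folklore] -/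
def nuQ (q : ℕ) : ℚ := c.frame.a0 ^ q * (2 * cellsMomentQ₂₃ c.frame.wL c.cells q)

/-- The polar shift `(−1)^{q/2}·2(a₀/2)^q/invTwoPiHi` of the table at (even) index `q`: feeding
`nuScale·ν + shift` to `WeilCert.pmQ` cancels its hard-wired `ζ` polar matrix `Sym` exactly. [folklore] -/
def symShiftQ (q : ℕ) : ℚ := (-1 : ℚ) ^ (q / 2) * 2 * (c.frame.a0 / 2) ^ q / invTwoPiHi

/-- Table of the claimed data. [folklore] -/
def nuTab : List ℚ := c.nuData

/-- Entry `q` of the claimed table is `nuScale·ν_q + symShift_q` up to `2^{-pnu}`. [folklore] -/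
def checkNuAt (q : ℕ) : Bool :=
  decide (|getV c.nuData q - (nuScale * c.nuQ q + c.symShiftQ q)| ≤ 1 / 2 ^ c.pnu)

/-- The claimed table is correct at the even indices `q ≤ 2N`. [folklore] -/
def checkNu : Bool := allBelow (c.frame.N + 1) fun j ↦ c.checkNuAt (2 * j)

/-- `ν'_abs = 2 a₀^{N+1} · (2 Σ_j bnd_j ∫_{cell j} s^{N+1}) / (N+1)!`: the `|γ|`-moment bound of the Taylor
remainder on the frequency side. [folklore] -/
def nuPrimeAbs : ℚ :=
  2 * (c.frame.a0 ^ (c.frame.N + 1) * (2 * cellsAbsMomentQ₂₃ c.frame.wL c.cells (c.frame.N + 1))) /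
    (c.frame.N + 1).factorial

/-- The coefficient of `‖g‖₂²` after all reductions, before rounding: level `wL + ellLo`, minus the price
of the rational `1/(2π)` against a SIGNED `γ`, minus the Taylor/rounding/table remainders (no polar price). [folklore] -/
def kappaExact : ℚ :=
  c.frame.wL + c.ellLo - 7 * (invTwoPiHi20 - invTwoPiLo20) * cellsBndMaxQ₂₃ c.frame.wL c.cells -
    2 * c.frame.a0 * (5 * invTwoPiHi20 * c.nuPrimeAbs +
      ((c.frame.N : ℚ) + 1) ^ 2 * (1 / 2 ^ c.frame.pg + invTwoPiHi / 2 ^ c.pnu))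

/-- `κ = rd(κ_exact)`. [folklore] -/
def kappaQ : ℚ := ratRd c.frame.pg c.kappaExact

/-- Scalar side conditions (`0 < b ≤ a₀ ≤ 1`, frequency cut-off vs `N`, Taylor remainder `≤ 1`, even `N + 1`,
`κ ≥ 0`). [folklore] -/
def checkScalars : Bool :=
  decide (0 < c.b) && decide (c.b ≤ c.frame.a0) && decide (c.frame.a0 ≤ 1) &&
    decide (0 < c.frame.T) && decide (2 * c.frame.a0 * c.frame.T ≤ (c.frame.N : ℚ) + 2) &&
    decide (2 * (c.frame.a0 * c.frame.T) ^ (c.frame.N + 1) / (c.frame.N + 1).factorial ≤ 1) &&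
    decide (c.frame.N + 1 = 2 * c.frame.nb) && decide (0 ≤ c.kappaQ)

/-- **The algebraic checker** (everything except the cells): scalars, table, the two parity blocks. [folklore] -/
def checkAlg : Bool :=
  c.checkScalars && c.checkNu && c.frame.checkBlockK c.nuTab c.kappaQ 0 && c.frame.checkBlockK c.nuTab c.kappaQ 1

end TwistCert23

namespace TwistCert23
variable {c : TwistCert23}

/-- Unpacking `checkAlg`. [folklore] -/
theorem checkAlg_spec (h : c.checkAlg = true) :
    c.checkScalars = true ∧ c.checkNu = true ∧
      c.frame.checkBlockK c.nuTab c.kappaQ 0 = true ∧ c.frame.checkBlockK c.nuTab c.kappaQ 1 = true := by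
  unfold checkAlg at h
  simp only [Bool.and_eq_true] at h
  exact ⟨h.1.1.1, h.1.1.2, h.1.2, h.2⟩

/-- Unpacking `checkScalars`. [folklore] -/
theorem twistScalars_spec (h : c.checkScalars = true) :
    (0 < c.b ∧ c.b ≤ c.frame.a0 ∧ c.frame.a0 ≤ 1) ∧ (0 < c.frame.T ∧
      2 * c.frame.a0 * c.frame.T ≤ (c.frame.N : ℚ) + 2 ∧
      2 * (c.frame.a0 * c.frame.T) ^ (c.frame.N + 1) / (c.frame.N + 1).factorial ≤ 1) ∧
      c.frame.N + 1 = 2 * c.frame.nb ∧ 0 ≤ c.kappaQ := by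
  unfold checkScalars at h
  simp only [Bool.and_eq_true, decide_eq_true_eq] at h
  exact ⟨⟨h.1.1.1.1.1.1.1, h.1.1.1.1.1.1.2, h.1.1.1.1.1.2⟩, ⟨h.1.1.1.1.2, h.1.1.1.2, h.1.1.2⟩, h.1.2, h.2⟩

/-- The table agrees with `nuScale·nuQ + symShift` at even `q ≤ 2N` up to `2^{-pnu}`. [folklore] -/
theorem abs_getV_nuTab_sub_le (h : c.checkNu = true) {q : ℕ} (hq : q ≤ 2 * c.frame.N) (he : q % 2 = 0) :
    |getV c.nuTab q - (nuScale * c.nuQ q + c.symShiftQ q)| ≤ 1 / 2 ^ c.pnu := by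
  unfold checkNu at h
  have := of_allBelow h (k := q / 2) (by omega)
  unfold checkNuAt at this
  rw [show 2 * (q / 2) = q by omega] at this
  simpa [nuTab] using this

/-! ### Moments of the minorant defect, all parities -/

variable {w : ℝ → ℝ}

/-- `∫ γ(t) t^q dt = 2 Σ_j momentQ_j(q)` for even `q`, `= 0` for odd `q`; and integrability. [folklore] -/
theorem integral_gamma_pow (hcells : CellsOKW23 c.frame.wL c.frame.T c.cells w) (q : ℕ) :
    Integrable (fun t ↦ cellsGamma₂₃ c.frame.wL c.cells t * t ^ q) ∧
      ∫ t, cellsGamma₂₃ c.frame.wL c.cells t * t ^ q =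
        if Even q then 2 * (cellsMomentQ₂₃ c.frame.wL c.cells q : ℝ) else 0 := by
  rcases Nat.even_or_odd q with hq | hq
  · rw [if_pos hq]; exact integral_cellsGamma₂₃_mul_powW hcells hq
  · rw [if_neg (Nat.not_even_iff_odd.2 hq)]
    have h0 := (integral_abs_cellsGamma₂₃_mul_pow_leW hcells (Even.zero)).1
    have h1 := (integral_abs_cellsGamma₂₃_mul_pow_leW hcells (hq.add_one)).1
    simp only [pow_zero, mul_one] at h0
    set γ := cellsGamma₂₃ c.frame.wL c.cells with hγ
    have hint : Integrable (fun t ↦ γ t * t ^ q) := by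
      refine Integrable.mono' (h0.add h1)
        (((measurable_cellsGamma₂₃ _ _).mul (measurable_id.pow_const q)).aestronglyMeasurable)
        (Eventually.of_forall fun t ↦ ?_)
      rw [Real.norm_eq_abs, abs_mul]
      simp only [Pi.add_apply]
      rw [show |γ t| + |γ t| * t ^ (q + 1) = |γ t| * (1 + t ^ (q + 1)) by ring]
      refine mul_le_mul_of_nonneg_left ?_ (abs_nonneg _)
      rw [abs_pow]
      rcases le_or_gt |t| 1 with ht | ht
      · have : |t| ^ q ≤ 1 := pow_le_one₀ (abs_nonneg t) ht
        have : 0 ≤ t ^ (q + 1) := by rw [← (hq.add_one).pow_abs]; positivity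
        linarith
      · have : |t| ^ q ≤ |t| ^ (q + 1) := pow_le_pow_right₀ ht.le (Nat.le_succ q)
        rw [(hq.add_one).pow_abs] at this
        linarith
    refine ⟨hint, ?_⟩
    have hodd : ∀ t, γ (-t) * (-t) ^ q = -(γ t * t ^ q) := by
      intro t; rw [hγ, cellsGamma₂₃_neg, hq.neg_pow]; ring
    have h := integral_neg_eq_self (fun t ↦ γ t * t ^ q) volume
    simp_rw [hodd] at h
    rw [integral_neg] at h
    linarith

/-- `ν_q = a₀^q ∫ γ(t) t^q dt` for even `q`. [folklore] -/
theorem nuQ_eq_integral (hcells : CellsOKW23 c.frame.wL c.frame.T c.cells w) {q : ℕ} (hq : Even q) :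
    ((c.nuQ q : ℚ) : ℝ) = (c.frame.a0 : ℝ) ^ q * ∫ t, cellsGamma₂₃ c.frame.wL c.cells t * t ^ q := by
  rw [(integral_gamma_pow hcells q).2, if_pos hq]
  unfold nuQ; push_cast; ring

/-! ### Step C: the frequency side -/

variable {g : ℝ → ℂ}

/-- The matrix `Ĝ` of the frequency side. [folklore] -/
def gHat (c : TwistCert23) (k l : ℕ) : ℝ :=
  if k % 2 = l % 2 then
    (-1 : ℝ) ^ k * (-1) ^ ((k + l) / 2) * ((c.nuQ (k + l) : ℚ) : ℝ) / (k.factorial * l.factorial)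
  else 0

/-- **Frequency bound (signed minorant defect).**
`∫ ‖ĝ(1/2+it)‖² γ(t) dt ≤ Σ Ĝ_{kl} Re(conj M_k M_l) + 5 ‖g‖₁² ν'_abs`. [folklore] -/
theorem freq_integral_bound (hcells : CellsOKW23 c.frame.wL c.frame.T c.cells w)
    (hsc : c.checkScalars = true) (hg : IsWeilTest g)
    (hsupp : tsupport g ⊆ Icc (-(c.frame.a0 : ℝ)) c.frame.a0) :
    ∫ t : ℝ, ‖weilMellin g (1 / 2 + t * I)‖ ^ 2 * cellsGamma₂₃ c.frame.wL c.cells t ≤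
      ∑ k ∈ range (c.frame.N + 1), ∑ l ∈ range (c.frame.N + 1),
          gHat c k l * (conj (weilMoment c.frame.a0 g k) * weilMoment c.frame.a0 g l).re +
        5 * weilNorm1 g ^ 2 * ((c.nuPrimeAbs : ℚ) : ℝ) := by
  obtain ⟨⟨hb0, hba, ha1⟩, ⟨hT, haT, hρT⟩, hN, -⟩ := twistScalars_spec hsc
  set a : ℝ := (c.frame.a0 : ℝ) with ha_def
  have ha : 0 < a := by
    have h1 : (0 : ℝ) < c.b := by exact_mod_cast hb0
    have h2 : ((c.b : ℚ) : ℝ) ≤ c.frame.a0 := by exact_mod_cast hba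
    rw [ha_def]; linarith
  set γ : ℝ → ℝ := cellsGamma₂₃ c.frame.wL c.cells with hγ
  set M : ℕ → ℂ := weilMoment a g with hM
  set n := c.frame.N + 1 with hn
  set L := weilNorm1 g with hL
  have hn_even : Even n := ⟨c.frame.nb, by omega⟩
  set W : ℕ → ℕ → ℝ := fun k l ↦
    (((-1 : ℂ) ^ k * I ^ (k + l)) * (conj (M k) * M l)).re with hW
  have hpt : ∀ t : ℝ, ‖weilMellin g (1 / 2 + t * I)‖ ^ 2 * γ t ≤
      (∑ k ∈ range n, ∑ l ∈ range n,
        W k l * (a ^ (k + l) / (k.factorial * l.factorial)) * (γ t * t ^ (k + l))) +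
        5 * L ^ 2 * (2 * a ^ n / n.factorial) * (|γ t| * t ^ n) := by
    intro t
    rcases lt_or_ge |t| (c.frame.T : ℝ) with ht | ht
    · have ht1 : 2 * a * |t| ≤ c.frame.N + 2 := by
        have h1 : 2 * a * |t| ≤ 2 * a * c.frame.T := by nlinarith
        have h2 : (2 * c.frame.a0 * c.frame.T : ℝ) ≤ c.frame.N + 2 := by exact_mod_cast haT
        rw [ha_def] at h1 ⊢; linarith
      have ht2 : 2 * (|t| * a) ^ (c.frame.N + 1) / (c.frame.N + 1).factorial ≤ 1 := by
        have h1 : (|t| * a) ^ (c.frame.N + 1) ≤ (c.frame.T * a) ^ (c.frame.N + 1) :=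
          pow_le_pow_left₀ (by positivity) (by nlinarith) _
        have h2 : (2 * (c.frame.a0 * c.frame.T) ^ (c.frame.N + 1) / (c.frame.N + 1).factorial : ℝ) ≤ 1 := by
          exact_mod_cast hρT
        rw [ha_def] at h1 ⊢
        rw [mul_comm (c.frame.a0 : ℝ)] at h2
        have h3 : 2 * (|t| * ↑c.frame.a0) ^ (c.frame.N + 1) / ((c.frame.N + 1).factorial : ℝ) ≤
            2 * (↑c.frame.T * ↑c.frame.a0) ^ (c.frame.N + 1) / ((c.frame.N + 1).factorial : ℝ) := by
          gcongr
        linarith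
      have h := WeilCert2.freq_pointwise_bound_abs hg ha hsupp c.frame.N ht1 ht2
      set S : ℝ := ∑ k ∈ range (c.frame.N + 1), ∑ l ∈ range (c.frame.N + 1),
          (((-1 : ℂ) ^ k * I ^ (k + l)) * (conj (M k) * M l)).re *
            ((t * a) ^ (k + l) / (k.factorial * l.factorial)) with hS
      set R : ℝ := 5 * (2 * (|t| * a) ^ (c.frame.N + 1) / (c.frame.N + 1).factorial) * L ^ 2 with hR
      have hR0 : 0 ≤ R := by rw [hR]; positivity
      have hdiff : |‖weilMellin g (1 / 2 + t * I)‖ ^ 2 - S| ≤ R := by rw [hS, hR, hM]; exact h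
      have hkey : ‖weilMellin g (1 / 2 + t * I)‖ ^ 2 * γ t ≤ S * γ t + R * |γ t| := by
        have e : ‖weilMellin g (1 / 2 + t * I)‖ ^ 2 * γ t =
            S * γ t + (‖weilMellin g (1 / 2 + t * I)‖ ^ 2 - S) * γ t := by ring
        rw [e]
        have := abs_mul (‖weilMellin g (1 / 2 + t * I)‖ ^ 2 - S) (γ t)
        have h2 : |‖weilMellin g (1 / 2 + t * I)‖ ^ 2 - S| * |γ t| ≤ R * |γ t| :=
          mul_le_mul_of_nonneg_right hdiff (abs_nonneg _)
        linarith [le_abs_self ((‖weilMellin g (1 / 2 + t * I)‖ ^ 2 - S) * γ t)]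
      refine hkey.trans (le_of_eq ?_)
      congr 1
      · rw [hS, Finset.sum_mul, ← hn]
        refine Finset.sum_congr rfl fun k _ ↦ ?_
        rw [Finset.sum_mul]
        refine Finset.sum_congr rfl fun l _ ↦ ?_
        rw [hW, mul_pow]
        simp only
        ring
      · rw [hR, ← hn_even.pow_abs t, hn, mul_pow]
        ring
    · have h0 : γ t = 0 := cellsGamma₂₃_eq_zeroW hcells ht
      rw [h0]
      simp
  obtain ⟨B, hB0, hB⟩ := exists_abs_cellsGamma₂₃_le c.frame.wL c.cells
  have hiL : Integrable fun t : ℝ ↦ ‖weilMellin g (1 / 2 + t * I)‖ ^ 2 * γ t :=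
    integrable_norm_sq_weilMellin_mul hg (measurable_cellsGamma₂₃ _ _) hB0 le_rfl (B := 0)
      (fun t ↦ by simpa using hB t)
  have hiq : ∀ q, Integrable fun t ↦ γ t * t ^ q := fun q ↦ (integral_gamma_pow hcells q).1
  obtain ⟨hiabs, habsle⟩ := integral_abs_cellsGamma₂₃_mul_pow_leW hcells hn_even
  have hiR : Integrable fun t ↦ (∑ k ∈ range n, ∑ l ∈ range n,
      W k l * (a ^ (k + l) / (k.factorial * l.factorial)) * (γ t * t ^ (k + l))) +
      5 * L ^ 2 * (2 * a ^ n / n.factorial) * (|γ t| * t ^ n) := by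
    refine Integrable.add (integrable_finsetSum _ fun k _ ↦ integrable_finsetSum _ fun l _ ↦
      (hiq (k + l)).const_mul _) (hiabs.const_mul _)
  have hint := integral_mono hiL hiR hpt
  refine hint.trans ?_
  rw [integral_add (integrable_finsetSum _ fun k _ ↦ integrable_finsetSum _ fun l _ ↦
      (hiq (k + l)).const_mul _) (hiabs.const_mul _),
    integral_finsetSum _ fun k _ ↦ integrable_finsetSum _ fun l _ ↦ (hiq (k + l)).const_mul _]
  refine add_le_add (le_of_eq ?_) ?_
  · refine Finset.sum_congr rfl fun k _ ↦ ?_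
    rw [integral_finsetSum _ fun l _ ↦ (hiq (k + l)).const_mul _]
    refine Finset.sum_congr rfl fun l _ ↦ ?_
    rw [integral_const_mul, (integral_gamma_pow hcells (k + l)).2, gHat]
    by_cases hkl : k % 2 = l % 2
    · have hev : Even (k + l) := (WeilCert.mod_two_eq_iff_even k l).1 hkl
      rw [if_pos hkl, if_pos hev, hW]
      simp only
      rw [WeilAna.I_pow_even hev,
        show ((-1 : ℂ) ^ k * (-1) ^ ((k + l) / 2)) * (conj (M k) * M l) =
          (((-1 : ℝ) ^ k * (-1) ^ ((k + l) / 2) : ℝ) : ℂ) * (conj (M k) * M l) by push_cast; ring,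
        Complex.re_ofReal_mul]
      unfold nuQ
      push_cast
      rw [hM, ha_def]
      ring
    · have hodd : ¬ Even (k + l) := fun h ↦ hkl ((WeilCert.mod_two_eq_iff_even k l).2 h)
      rw [if_neg hkl, if_neg hodd]
      simp
  · rw [integral_const_mul]
    have hfac : 0 ≤ 5 * L ^ 2 * (2 * a ^ n / n.factorial) := by positivity
    have := mul_le_mul_of_nonneg_left habsle hfac
    refine this.trans (le_of_eq ?_)
    unfold nuPrimeAbs
    push_cast
    rw [hn, ha_def]
    ring

/-! ### The exact matrix: the shifted table cancels the polar part -/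

/-- The exact rational matrix `−invTwoPiHi20 · Ĝ(ν)` that the shifted table realises through `WeilCert.pmQ`. [folklore] -/
def pmQexact (c : TwistCert23) (k l : ℕ) : ℚ :=
  if k % 2 = l % 2 then
    -(invTwoPiHi * ((-1 : ℚ) ^ k * (-1 : ℚ) ^ ((k + l) / 2) * (nuScale * c.nuQ (k + l)) /
        (k.factorial * l.factorial)))
  else 0

/-- The hard-wired polar matrix `Sym_{kl} = (−1)^k·2·τ(k)τ(l)` of `WeilCert.pmQ` equals the contribution of
the shift `symShift_{k+l}` (for all indices; used at equal parity). [folklore] -/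
theorem sym_eq_shift (k l : ℕ) :
    (-1 : ℚ) ^ k * 2 * c.frame.tauQ k * c.frame.tauQ l =
      invTwoPiHi * ((-1 : ℚ) ^ k * (-1 : ℚ) ^ ((k + l) / 2) * c.symShiftQ (k + l) /
        (k.factorial * l.factorial)) := by
  have hq : (invTwoPiHi : ℚ) ≠ 0 := by unfold invTwoPiHi piLo; norm_num
  have hsq : ((-1 : ℚ) ^ ((k + l) / 2)) * ((-1 : ℚ) ^ ((k + l) / 2)) = 1 := by
    rw [← pow_add, ← two_mul]; exact (Even.neg_one_pow ⟨(k + l) / 2, by ring⟩)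
  have e : invTwoPiHi * ((-1 : ℚ) ^ k * (-1 : ℚ) ^ ((k + l) / 2) * c.symShiftQ (k + l) /
        (k.factorial * l.factorial)) =
      ((-1 : ℚ) ^ k * 2 * (c.frame.a0 / 2) ^ (k + l) / (k.factorial * l.factorial)) *
        (((-1 : ℚ) ^ ((k + l) / 2)) * ((-1 : ℚ) ^ ((k + l) / 2))) * (invTwoPiHi / invTwoPiHi) := by
    unfold symShiftQ; ring
  rw [e, hsq, div_self hq, mul_one, mul_one, pow_add]
  unfold WeilCert.tauQ; ring

/-- Table tolerance: `|pmQ ν̃ k l − pmQexact k l| ≤ invTwoPiHi · 2^{-pnu}` for `k, l ≤ N`. [folklore] -/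
theorem abs_pmQ_sub_pmQexact_le (hnu : c.checkNu = true) {k l : ℕ} (hk : k < c.frame.N + 1)
    (hl : l < c.frame.N + 1) :
    |c.frame.pmQ c.nuTab k l - pmQexact c k l| ≤ invTwoPiHi * (1 / 2 ^ c.pnu) := by
  have hq6 : (0 : ℚ) ≤ invTwoPiHi := by unfold invTwoPiHi piLo; norm_num
  unfold WeilCert.pmQ pmQexact
  by_cases hkl : k % 2 = l % 2
  · have htab := abs_getV_nuTab_sub_le hnu (q := k + l) (by omega) (by omega)
    rw [if_pos hkl, if_pos hkl, sym_eq_shift (c := c) k l]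
    have hf : (0 : ℚ) < (k.factorial : ℚ) * (l.factorial : ℚ) := by positivity
    have hff : (1 : ℚ) ≤ (k.factorial : ℚ) * (l.factorial : ℚ) := by
      have h1 : (1 : ℚ) ≤ k.factorial := by exact_mod_cast Nat.one_le_iff_ne_zero.2 (Nat.factorial_ne_zero k)
      have h2 : (1 : ℚ) ≤ l.factorial := by exact_mod_cast Nat.one_le_iff_ne_zero.2 (Nat.factorial_ne_zero l)
      nlinarith
    have e : invTwoPiHi * ((-1 : ℚ) ^ k * (-1 : ℚ) ^ ((k + l) / 2) * c.symShiftQ (k + l) /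
          (k.factorial * l.factorial)) -
        invTwoPiHi * ((-1 : ℚ) ^ k * (-1 : ℚ) ^ ((k + l) / 2) * getV c.nuTab (k + l) /
          (k.factorial * l.factorial)) -
        -(invTwoPiHi * ((-1 : ℚ) ^ k * (-1 : ℚ) ^ ((k + l) / 2) * (nuScale * c.nuQ (k + l)) /
            (k.factorial * l.factorial))) =
        -(invTwoPiHi * ((-1 : ℚ) ^ k * (-1 : ℚ) ^ ((k + l) / 2)) / (k.factorial * l.factorial)) *
          (getV c.nuTab (k + l) - (nuScale * c.nuQ (k + l) + c.symShiftQ (k + l))) := by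
      field_simp
      ring
    rw [e, abs_mul, abs_neg]
    have hsgn : |invTwoPiHi * ((-1 : ℚ) ^ k * (-1 : ℚ) ^ ((k + l) / 2)) / (k.factorial * l.factorial)| ≤
        invTwoPiHi := by
      rw [abs_div, abs_mul, abs_mul, abs_pow, abs_pow, abs_neg, abs_one, one_pow, one_pow, mul_one,
        abs_of_nonneg hq6, abs_of_pos hf, mul_one]
      exact div_le_self hq6 hff
    exact mul_le_mul hsgn htab (abs_nonneg _) hq6
  · rw [if_neg hkl, if_neg hkl, sub_self, abs_zero]
    positivity

/-- Entry identity for the exact matrix: `(pmQexact k l : ℝ) = −q₂₀ Ĝ_{kl}` — NO polar term. [folklore] -/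
theorem pmQexact_cast (k l : ℕ) :
    ((pmQexact c k l : ℚ) : ℝ) = -(((invTwoPiHi20 : ℚ) : ℝ) * gHat c k l) := by
  unfold pmQexact gHat
  by_cases hkl : k % 2 = l % 2
  · rw [if_pos hkl, if_pos hkl, ← invTwoPiHi_mul_nuScale]
    push_cast
    ring
  · rw [if_neg hkl, if_neg hkl]
    simp

end TwistCert23

end Summit.Ventures.WeilGRH

end
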